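import Summits.QuantumFields.YangMills.Theorems.FemtoTransferGapEigenbasis
import HarnessLib

/-!
# Route `LuscherReduction`, item `DressedRitz` (stmt-QuantumFields-20205) — CAUCHY INTERLACING for Ritz families of the zero-flux transfer operator:
# the `j`-th Ritz value of an `l2`-orthonormal, `qform`-diagonal, antitone physical family is `≤ λ_j = levelValue su2Rep L β j`

Support module (LEAD prover ym-lead-20205-polyakovlift g0; `--supports stmt-QuantumFields-20205`, helper; BLUEPRINT-S-UNIV §6).  The crux `DressedRitz`
asks for Ritz families `φ₀ … φ_k` (physical, `l2`-orthonormal, `qform`-diagonal, antitone Ritz values `ρ_j = qform(φ_j,φ_j)`) whose Ritz values sit in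
two-sided Lüscher position against the one-site levels.  The UPPER half is LEVEL DATA: by Courant–Fischer (tree `exists_isPhys_eigenseq`, domination clause)
and a dimension count, `ρ_j ≤ λ_j(β,L)` for EVERY such family — so `ρ_j/λ₀ ≤ e^{Cλ²/L}μ_j(B)/μ₀(B)` follows from the comparison of the EXACT fine levels with the
one-site levels alone (one-loop Lüscher levels), with no information on the trial vectors.  Only the LOWER half needs the insertions.

* `bilin_sum_smul_left`, `bilin_sum_smul_diag` — expansion of a bilinear form on a finite linear combination (left slot ∕ diagonal family);
* `exists_ne_zero_orth` — `j+1` vectors admit a nontrivial combination orthogonal to `j` given vectors (rank–nullity);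
* ★ `ritz_le_levelValue` — the interlacing inequality `qform su2Rep β (φ j) (φ j) ≤ levelValue su2Rep L β j`.

HONEST FRAMING: fixed-lattice linear algebra on the conditional femto rung R2b1; the level comparison itself is OPEN RG content; nothing here bears on infinite
volume, the continuum limit or the Clay gap.  References: Reed–Simon IV Thm XIII.1–2 [cite: ReedSimonIV1978, Thm. XIII.1–2]; B. N. Parlett, The Symmetric
Eigenvalue Problem, §10.1 (Cauchy interlace) [cite: Parlett1998, §10.1].
-/

set_option autoImplicit false

noncomputable section

open MeasureTheory Filter Topology Real
open Literature.MathematicalPhysics.QuantumFieldTheory (GaugeConfig Site gaugeTransform)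
open scoped BigOperators

namespace Summit.QuantumFields.YangMills.Theorems.FemtoTransferGap.RitzInterlace

open Summit.QuantumFields.YangMills.Theorems.FemtoTransferGap

/-! ## §1 Bilinear bookkeeping -/

section Abstract

variable {D : Type*} [AddCommGroup D] [Module ℝ D]

/-- Left-slot expansion of a bilinear form on a finite combination. [folklore] -/
theorem bilin_sum_smul_left (B : D →ₗ[ℝ] D →ₗ[ℝ] ℝ) {n : ℕ} (x : Fin n → D) (c : Fin n → ℝ) (y : D) :
    B (∑ i, c i • x i) y = ∑ i, c i * B (x i) y := by
  rw [map_sum, LinearMap.sum_apply]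
  refine Finset.sum_congr rfl fun i _ => ?_
  rw [map_smul, LinearMap.smul_apply, smul_eq_mul]

/-- Diagonal expansion: if `B(x_i,x_l) = δ_il d_i` then `B(Σc_i x_i, Σc_i x_i) = Σ c_i² d_i`. [folklore] -/
theorem bilin_sum_smul_diag (B : D →ₗ[ℝ] D →ₗ[ℝ] ℝ) {n : ℕ} (x : Fin n → D) (d : Fin n → ℝ)
    (hB : ∀ i l, B (x i) (x l) = if i = l then d i else 0) (c : Fin n → ℝ) :
    B (∑ i, c i • x i) (∑ i, c i • x i) = ∑ i, c i ^ 2 * d i := by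
  rw [bilin_sum_smul_left]
  refine Finset.sum_congr rfl fun i _ => ?_
  have hinner : B (x i) (∑ l, c l • x l) = c i * d i := by
    rw [map_sum]
    have : ∀ l, B (x i) (c l • x l) = if i = l then c i * d i else 0 := fun l => by
      rw [map_smul, smul_eq_mul, hB]
      split_ifs with h
      · subst h; rfl
      · rw [mul_zero]
    simp_rw [this]
    rw [Finset.sum_ite_eq]; simp
  rw [hinner]; ring

end Abstract

/-! ## §2 A nontrivial combination orthogonal to `j` given vectors -/

/-- `j+1` coefficients, `j` linear constraints: a nontrivial solution exists (rank–nullity). [folklore] -/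
theorem exists_ne_zero_orth {j : ℕ} (M : Matrix (Fin j) (Fin (j + 1)) ℝ) :
    ∃ c : Fin (j + 1) → ℝ, c ≠ 0 ∧ Matrix.mulVec M c = 0 := by
  have hlt : Module.finrank ℝ (Fin j → ℝ) < Module.finrank ℝ (Fin (j + 1) → ℝ) := by
    simp only [Module.finrank_fin_fun]; omega
  have hker : LinearMap.ker (Matrix.mulVecLin M) ≠ ⊥ := LinearMap.ker_ne_bot_of_finrank_lt hlt
  obtain ⟨c, hc, hc0⟩ := (Submodule.ne_bot_iff _).mp hker
  exact ⟨c, hc0, by simpa using hc⟩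

/-! ## §3 ★ Interlacing -/

/-- ★★ **Cauchy interlacing for Ritz families**: for a physical, `l2`-orthonormal, `qform`-diagonal family `φ₀ … φ_k` with antitone Ritz values,
`qform(φ_j, φ_j) ≤ levelValue su2Rep L β j` for every `j ≤ k` (`β > 0`). [cite: Parlett1998, §10.1] [cite: ReedSimonIV1978, Thm. XIII.1–2] -/
theorem ritz_le_levelValue {L : ℕ} [NeZero L] {β : ℝ} (hβ : 0 < β) {k : ℕ} {φ : Fin (k + 1) → (GaugeConfig 3 L SU2 → ℝ)}
    (hφ : ∀ i, IsPhys (φ i)) (hon : ∀ i l, l2 (φ i) (φ l) = if i = l then 1 else 0)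
    (hdiag : ∀ i l, i ≠ l → qform su2Rep β (φ i) (φ l) = 0)
    (hanti : ∀ i l : Fin (k + 1), i ≤ l → qform su2Rep β (φ l) (φ l) ≤ qform su2Rep β (φ i) (φ i)) (j : Fin (k + 1)) :
    qform su2Rep β (φ j) (φ j) ≤ levelValue su2Rep L β j := by
  classical
  obtain ⟨e, hone, heig, hdom, -⟩ := exists_isPhys_eigenseq (L := L) hβ
  set n : ℕ := (j : ℕ) with hn
  have hnk : n + 1 ≤ k + 1 := by have := j.isLt; omega
  -- the first `n+1` members as elements of the physical submodule
  set x : Fin (n + 1) → physSubmodule L := fun i => ⟨φ (Fin.castLE hnk i), hφ _⟩ with hx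
  -- the constraint matrix and a nontrivial solution
  set M : Matrix (Fin n) (Fin (n + 1)) ℝ := fun m i =>
    l2 (φ (Fin.castLE hnk i)) ((e m : physSubmodule L) : GaugeConfig 3 L SU2 → ℝ) with hM
  obtain ⟨c, hc0, hMc⟩ := exists_ne_zero_orth M
  set ψ : physSubmodule L := ∑ i, c i • x i with hψ
  -- orthogonality to `e_0 … e_{n-1}`
  have horth : ∀ m : ℕ, m < n → l2 ((ψ : physSubmodule L) : GaugeConfig 3 L SU2 → ℝ) ((e m : physSubmodule L) : GaugeConfig 3 L SU2 → ℝ) = 0 := by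
    intro m hm
    have h := congrFun hMc ⟨m, hm⟩
    rw [Pi.zero_apply, Matrix.mulVec, dotProduct] at h
    rw [← l2Form_apply, hψ, bilin_sum_smul_left]
    rw [← h]
    refine Finset.sum_congr rfl fun i _ => ?_
    rw [l2Form_apply, hM, mul_comm]
  -- Courant–Fischer domination at level `n`
  have hdomψ := hdom n ((ψ : physSubmodule L) : GaugeConfig 3 L SU2 → ℝ) ψ.2 (fun i hi => horth i hi)
  -- Gram and form of `ψ`
  have hGram : l2 ((ψ : physSubmodule L) : GaugeConfig 3 L SU2 → ℝ) ψ = ∑ i, c i ^ 2 * 1 := by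
    rw [← l2Form_apply, hψ]
    refine bilin_sum_smul_diag (l2Form L) x (fun _ => (1 : ℝ)) (fun i l => ?_) c
    rw [l2Form_apply, hx, hon]
    simp only [(Fin.castLE_injective hnk).eq_iff]
  set Q : physSubmodule L →ₗ[ℝ] physSubmodule L →ₗ[ℝ] ℝ := (l2Form L).compl₂ (transferOp β) with hQ
  have hQapply : ∀ a b : physSubmodule L, Q a b = qform su2Rep β (a : GaugeConfig 3 L SU2 → ℝ) b := fun a b => by
    rw [hQ, LinearMap.compl₂_apply, l2Form_apply, coe_transferOp, qform_eq_l2_transferApply]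
  have hForm : qform su2Rep β ((ψ : physSubmodule L) : GaugeConfig 3 L SU2 → ℝ) ψ =
      ∑ i, c i ^ 2 * qform su2Rep β (φ (Fin.castLE hnk i)) (φ (Fin.castLE hnk i)) := by
    rw [← hQapply, hψ]
    refine bilin_sum_smul_diag Q x _ (fun i l => ?_) c
    rw [hQapply, hx]
    split_ifs with h
    · subst h; rfl
    · exact hdiag _ _ (fun heq => h (Fin.castLE_injective hnk heq))
  -- the chain `ρ_j Σc² ≤ Σ c² ρ_i ≤ λ_n Σ c²`
  have hS : 0 < ∑ i, c i ^ 2 := by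
    obtain ⟨i, hi⟩ := Function.ne_iff.mp hc0
    have hi' : c i ≠ 0 := by simpa using hi
    exact lt_of_lt_of_le (sq_pos_iff.mpr hi') (Finset.single_le_sum (fun l _ => sq_nonneg (c l)) (Finset.mem_univ i))
  have hlow : qform su2Rep β (φ j) (φ j) * ∑ i, c i ^ 2 ≤ ∑ i, c i ^ 2 * qform su2Rep β (φ (Fin.castLE hnk i)) (φ (Fin.castLE hnk i)) := by
    rw [Finset.mul_sum]
    refine Finset.sum_le_sum fun i _ => ?_
    rw [mul_comm]
    refine mul_le_mul_of_nonneg_left (hanti _ _ ?_) (sq_nonneg _)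
    rw [Fin.le_def, Fin.val_castLE]
    have := i.isLt; omega
  have hupp : ∑ i, c i ^ 2 * qform su2Rep β (φ (Fin.castLE hnk i)) (φ (Fin.castLE hnk i)) ≤ levelValue su2Rep L β n * ∑ i, c i ^ 2 := by
    rw [← hForm]
    have h := hdomψ
    rw [hGram] at h
    simpa using h
  exact le_of_mul_le_mul_right (hlow.trans hupp) hS

end Summit.QuantumFields.YangMills.Theorems.FemtoTransferGap.RitzInterlace

end
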